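import Summits.BirchSwinnertonDyer.Rank1Residual.GaloisImage.SakamotoN11InstanceFitting
import Literature.NumberTheory.GaloisRepresentations.LocalGlobalCohomologyDualityProofs
import HarnessLib

/-!
# A level-one Kolyvagin system with `κ_d ≠ 0` kills the dual Selmer group `N_d` (`m = 1`):
# the T-a5x link "level-1 certificate ⟹ dual Selmer vanishing", generic algebra + the N11 reading
# (cell `b2b-bsdres`, team n1011, row T-a5x — EXOTIC unit case via level-1 Kolyvagin systems; seat p13)

HONEST FRAMING (cell `b2b-bsdres`, run/shared/lean/b2b/bsd-rank1-residual/, verbatim in every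
file): the goal of the cell is to DELETE the COMBINATION-SHAPED residual classes of the
Birch–Swinnerton-Dyer formula for ALL analytic-rank `≤ 1` elliptic curves over `ℚ` — "full BSD
formula for every rank `≤ 1` curve in class `C`" assembled STRICTLY from published theorems — so
that the rank-`≤ 1` remainder becomes exactly the CONSTRUCTION-SHAPED classes, which are TYPED
(missing-input `Prop`s), NOT attempted. This is not "finishing BSD". Team n1011 (N10/N11, the
additive block `X4 ∧ p = 3`): research route; no claim beyond the stated classes; the label X4 and
the mark of RESIDUAL-MAP §I N11 are UNCHANGED by this file; nothing is booked. Theorems only: no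
definition, no named fact is minted. The N11 end theorem is CONDITIONAL on the tree's two named
facts `Sakamoto2024.kolyvaginSystems_freeRankOne_zmod_three_pow` (Thm. 4.4 (1); p13, p254540) and
`Sakamoto2024.kolyvaginSystems_idealOfBasis_eq_fittingIdeal_zmod_three_pow` (Thm. 4.4 (2); p11,
R1-22), on Tate's local Euler–Poincaré characteristic (`hEP`), and on a LEVEL-ONE CERTIFICATE
(a Kolyvagin system with a non-zero class — binder, not constructed here), all explicit.

## What and why

Row T-a5x (EXOTIC unit case of X4♯(3) via level-1 Kolyvagin systems) needs the implication
"a Kolyvagin system `κ ∈ KS₁(E[3], 𝓕_can, 𝒫)` with `κ₁ ≠ 0` ⟹ the dual Selmer group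
`H¹_{𝓕_can^*}(ℚ, E[3]^∨(1))` vanishes" at `m = 1`.  It is two lines of algebra over Sakamoto's
Thm. 4.4: by (1) `KS₁ ≅ 𝔽₃`, so `κ = a·g` for a generator `g`, whence `g_d ≠ 0`; by (2) at the
level `d` (p11's unfolding, second clause) `3 ∣ #N_d ⟹ g_d = 0`; and `N_d` is killed by `3`, so
`3 ∤ #N_d` forces `#N_d = 1`.

* `LevelOne.apply_ne_zero_of_zmultiples_eq_top`, `LevelOne.exists_zmultiples_eq_top_of_isFreeRankOneZMod`,
  `LevelOne.natCard_eq_one_of_prime_of_not_dvd`, `LevelOne.natCard_eq_one_of_apply_ne_zero` — the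
  generic algebra (any prime `p`, any group of functions, any `p`-torsion group `A`).
* `dualSelmerGroup_natCard_eq_one_levelOne_of_surj_of_apply_ne_zero` — the N11 reading at level one
  from surj(3) ALONE (no tower ⇒ every surj(3) row incl. EXOTIC): over p13's
  `kolyvaginSystems_freeRankOne_levelOne_of_surj_of_localInputs` (p260877) and
  `kolyvaginSystems_idealOfBasis_levelOne_of_surj_of_localInputs` (`SakamotoN11InstanceFitting`),
  for any level `d` and any `κ ∈ KS₁(E[3], 𝓕_can, 𝒫(τ))` with `κ_d ≠ 0`:
  `#H¹_{𝓕_can(d)^*}(ℚ, E[3]^∨(1)) = 1`.  Binders: the two facts, the two `Finite` instances, surj(3),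
  the `τ`-datum, the residual Poitou–Tate family `inv` ×4, `hEP`, (Lp) `hLpIm`, an
  admissible `S`, the Kolyvagin datum, the full-level family `inv'` ×4, `d`, and the certificate
  `κ`, `hκ`.

What is NOT here: the certificate (Kato's Kolyvagin system at level one with a `3`-unit bottom
class: explicit reciprocity / DICT3 (route R1-21), unit `L`-value, `E(ℚ₃)[3] = 0`); the passage from
`N_∅ = 0` to `Sel₃(E/ℚ) = 0` (core rank + the Kummer inclusion + `loc₃^s κ₁ ≠ 0`; next file); any
class theorem or BSD consequence.

References: R. Sakamoto, JTNB 36 (2024) Thm. 4.4 (p. 926) [Sakamoto2024]; B. Mazur, K. Rubin,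
Mem. AMS 799 (2004) Cor. 4.5.2 [MazurRubin2004]; J. S. Milne, *ADT* I §2 [MilneADT2006].
-/

noncomputable section

open scoped Classical NumberField ContRepresentation
open Field NumberField IsDedekindDomain
open WeierstrassCurve Literature.NumberTheory.EllipticCurves Literature.NumberTheory.GaloisRepresentations
  Literature.NumberTheory.GaloisRepresentations.DiscreteGaloisModule Literature.NumberTheory.GaloisCohomology

namespace Summit.BirchSwinnertonDyer.Rank1Residual.GaloisImage

namespace LevelOne

/-! ### Generic algebra: generators of a free rank-one `ℤ/N`-module of functions -/

/-- In a group `X` of functions, if some `κ ∈ X` has `κ d ≠ 0` then every generator `g` of `X`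
(`ℤg = X`) has `g d ≠ 0`. [folklore] -/
theorem apply_ne_zero_of_zmultiples_eq_top {ι G : Type*} [AddCommGroup G]
    {X : AddSubgroup (ι → G)} {κ g : X} (hg : AddSubgroup.zmultiples g = ⊤) {d : ι}
    (hκ : κ.1 d ≠ 0) : g.1 d ≠ 0 := by
  intro h0
  have hmem : κ ∈ AddSubgroup.zmultiples g := hg ▸ AddSubgroup.mem_top κ
  obtain ⟨n, hn⟩ := AddSubgroup.mem_zmultiples_iff.mp hmem
  apply hκ
  have h1 : (κ : ι → G) = n • (g : ι → G) := by rw [← hn, AddSubgroupClass.coe_zsmul]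
  rw [h1, Pi.smul_apply, h0, smul_zero]

/-- A free rank-one `ℤ/N`-module (`X ≃+ ℤ/N`) has a generator. [folklore] -/
theorem exists_zmultiples_eq_top_of_isFreeRankOneZMod {X : Type*} [AddCommGroup X] {N : ℕ}
    [NeZero N] (h : KolyvaginSystem.IsFreeRankOneZMod X N) :
    ∃ g : X, AddSubgroup.zmultiples g = ⊤ := by
  obtain ⟨e⟩ := h
  refine ⟨e.symm 1, (AddSubgroup.eq_top_iff' _).mpr fun x => ?_⟩
  refine AddSubgroup.mem_zmultiples_iff.mpr ⟨(ZMod.cast (e x) : ℤ), ?_⟩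
  rw [← map_zsmul, zsmul_one, ZMod.intCast_zmod_cast, AddEquiv.symm_apply_apply]

/-- A group killed by a prime `p` whose cardinality is not divisible by `p` is trivial
(`Nat.card = 1`; an infinite group has `Nat.card = 0`, divisible by `p`). [folklore] -/
theorem natCard_eq_one_of_prime_of_not_dvd {A : Type*} [AddGroup A] {p : ℕ} (hp : p.Prime)
    (hexp : ∀ a : A, p • a = 0) (hndvd : ¬ p ∣ Nat.card A) : Nat.card A = 1 := by
  have hcard0 : Nat.card A ≠ 0 := fun h => hndvd (h ▸ dvd_zero p)
  haveI : Finite A := Nat.finite_of_card_ne_zero hcard0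
  by_contra hne
  have hlt : 1 < Nat.card A := lt_of_le_of_ne (Nat.one_le_iff_ne_zero.mpr hcard0) (Ne.symm hne)
  haveI : Nontrivial A := Finite.one_lt_card_iff_nontrivial.mp hlt
  obtain ⟨a, ha⟩ := exists_ne (0 : A)
  have hdvd : addOrderOf a ∣ p := addOrderOf_dvd_of_nsmul_eq_zero (hexp a)
  rcases (Nat.dvd_prime hp).mp hdvd with h1 | hpa
  · exact ha (AddMonoid.addOrderOf_eq_one_iff.mp h1)
  · exact hndvd (hpa ▸ addOrderOf_dvd_natCard a)

/-- **The abstract link.**  Let `X ≤ (ι → G)` be free of rank one over `ℤ/p` (Sakamoto Thm. 4.4 (1)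
at `m = 1`), let `A` be a group killed by the prime `p` (a dual Selmer group at `m = 1`), and
suppose the second clause of Thm. 4.4 (2) at the level `d`: for every generator `g` of `X`,
`p ∣ #A ⟹ g d = 0`.  Then ONE element `κ ∈ X` with `κ d ≠ 0` forces `#A = 1`. [folklore] -/
theorem natCard_eq_one_of_apply_ne_zero {ι G A : Type*} [AddCommGroup G] [AddGroup A]
    {X : AddSubgroup (ι → G)} {p : ℕ} (hp : p.Prime)
    (hfree : KolyvaginSystem.IsFreeRankOneZMod X p) (hexp : ∀ a : A, p • a = 0) {d : ι}
    (h2 : ∀ g : X, AddSubgroup.zmultiples g = ⊤ → p ∣ Nat.card A → g.1 d = 0)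
    (κ : X) (hκ : κ.1 d ≠ 0) : Nat.card A = 1 := by
  haveI : NeZero p := ⟨hp.ne_zero⟩
  obtain ⟨g, hg⟩ := exists_zmultiples_eq_top_of_isFreeRankOneZMod hfree
  exact natCard_eq_one_of_prime_of_not_dvd hp hexp
    fun hdvd => apply_ne_zero_of_zmultiples_eq_top hg hκ (h2 g hg hdvd)

end LevelOne

/-! ### The N11 reading at level one (`T = E[3^0·3]`, `𝓕_can = propagatedSelmerStructure W 3 0`) -/

variable (W : WeierstrassCurve ℚ) [W.IsElliptic]

/-- **Level-one certificate ⟹ dual Selmer vanishing, on every surj(3) row (incl. EXOTIC).**  In the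
setting of the level-one N11 instance from surj(3) ALONE (p260877 / `SakamotoN11InstanceFitting`):
if SOME Kolyvagin system `κ ∈ KS₁(E[3], 𝓕_can, 𝒫(τ))` has `κ_d ≠ 0` at a level `d`, then the dual
Selmer group `N_d = H¹_{𝓕_can(d)^*}(ℚ, E[3]^∨(1))` (for the full-level Poitou–Tate family `inv'`)
is TRIVIAL.  Proof: `KS₁ ≅ 𝔽₃` (Thm. 4.4 (1), `hS24`), so `κ = a·g` for a generator `g` with
`g_d ≠ 0`; Thm. 4.4 (2) (`hS24₂`) at `d`: `3 ∣ #N_d ⟹ g_d = 0`; `N_d` is killed by `3`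
(`TateDual.nsmul_eq_zero`, `galoisCohomology.nsmul_eq_zero_of_forall`), so `3 ∤ #N_d` forces
`#N_d = 1`.  At `d = ∅` (`D.isLevel_empty`) this is the T-a5x link: a LEVEL-ONE CERTIFICATE
`κ₁ ≠ 0` — in practice Kato's Kolyvagin system with a `3`-unit bottom class (explicit reciprocity
law + unit `L`-value + `E(ℚ₃)[3] = 0`; NOT constructed here, it is the binder `κ`, `hκ`) — kills
`H¹_{𝓕_can^*}(ℚ, E[3]^∨(1))`.  Binders (nothing hidden): the two named facts `hS24`, `hS24₂`, the
two `Finite` instances, surj(3), the `τ`-datum, the residual family `inv` ×4, `hEP`, (Lp)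
`hLpIm`, an admissible `S`, the Kolyvagin datum, the full-level family `inv'` ×4, the level `d`, the
certificate `κ`, `hκ`.  No tower; nothing booked; no mark changed.
[cite: Sakamoto2024, Thm. 4.4 (1)–(2) (p. 926)] -/
theorem dualSelmerGroup_natCard_eq_one_levelOne_of_surj_of_apply_ne_zero
    (hS24 : Sakamoto2024.kolyvaginSystems_freeRankOne_zmod_three_pow)
    (hS24₂ : Sakamoto2024.kolyvaginSystems_idealOfBasis_eq_fittingIdeal_zmod_three_pow)
    [Finite (geomTorsion W ((3 : ℕ) : ℤ))] [Finite (geomTorsion W (((3 : ℕ) : ℤ) ^ 0 * ((3 : ℕ) : ℤ)))]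
    (h3 : W.HasSurjectiveModNGaloisRep ((3 : ℕ) : ℤ))
    (τ : absoluteGaloisGroup ℚ) (hτμ : τ ∈ rootsOfUnityFixer ℚ (3 ^ (0 + 1)))
    (hτq : Nonempty (cokerSubOne (W.torsionGaloisModule (((3 : ℕ) : ℤ) ^ 0 * ((3 : ℕ) : ℤ))) τ ≃+
      ZMod (3 ^ (0 + 1))))
    (inv : LocalInvariants ℚ 3) (hperf : inv.IsPerfect) (hsum : inv.SumLocalTermEqZero)
    (hunro : inv.UnramifiedOrthogonal) (hcompl : inv.SelmerComplement)
    (hEP : ∀ v : HeightOneSpectrum (𝓞 ℚ), localEulerPoincareCharacteristic (v.adicCompletion ℚ))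
    (hLpIm : ∀ v : HeightOneSpectrum (𝓞 ℚ), ((3 : ℕ) : 𝓞 ℚ) ∈ v.asIdeal →
      Nat.card (propagatedSelmerStructureOne W 3 (Sum.inr v)) =
        9 * Nat.card (nsmulAddMonoidHom 3 :
          (W.baseChange (v.adicCompletion ℚ)).toAffine.Point →+ _).ker)
    (S : Finset (Place ℚ)) (hS : ∀ w : InfinitePlace ℚ, (Sum.inl w : Place ℚ) ∈ S)
    (h3S : ∀ v : HeightOneSpectrum (𝓞 ℚ), ((3 : ℕ) : 𝓞 ℚ) ∈ v.asIdeal → (Sum.inr v : Place ℚ) ∈ S)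
    (hbadS : ∀ v : HeightOneSpectrum (𝓞 ℚ), ¬ W.HasGoodReductionAt v → (Sum.inr v : Place ℚ) ∈ S)
    (D : KolyvaginDatum (W.torsionGaloisModule (((3 : ℕ) : ℤ) ^ 0 * ((3 : ℕ) : ℤ))))
    (η : (q : HeightOneSpectrum (𝓞 ℚ)) → (ZMod (Ideal.absNorm q.asIdeal))ˣ)
    (hP : D.primes = frobeniusClassPrimes (W.torsionGaloisModule (((3 : ℕ) : ℤ) ^ 0 * ((3 : ℕ) : ℤ)))
      {v | (Sum.inr v : Place ℚ) ∈ S} τ (3 ^ (0 + 1)))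
    (hT : D.transverse =
      cyclotomicTransverse (W.torsionGaloisModule (((3 : ℕ) : ℤ) ^ 0 * ((3 : ℕ) : ℤ))))
    (hD : D.HasCanonicalComparison (3 ^ (0 + 1)) η)
    (inv' : LocalInvariants ℚ (3 ^ (0 + 1))) (hperf' : inv'.IsPerfect)
    (hsum' : inv'.SumLocalTermEqZero) (hunro' : inv'.UnramifiedOrthogonal)
    (hcompl' : inv'.SelmerComplement)
    (d : Finset (HeightOneSpectrum (𝓞 ℚ))) (hd : D.IsLevel d)
    (κ : D.kolyvaginSystems (propagatedSelmerStructure W 3 0)) (hκ : κ.1 d ≠ 0) :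
    Nat.card (inv'.dualSelmerStructure (W.torsionGaloisModule (((3 : ℕ) : ℤ) ^ 0 * ((3 : ℕ) : ℤ)))
        (D.atLevel (propagatedSelmerStructure W 3 0) d)).selmerGroup = 1 := by
  have hfree := (kolyvaginSystems_freeRankOne_levelOne_of_surj_of_localInputs W hS24 h3 τ hτμ hτq
    inv hperf hsum hunro hcompl (fun v => (hperf v).1.injective) hEP hLpIm S hS h3S hbadS D η hP hT hD).1
  have h2 := fun (g : D.kolyvaginSystems (propagatedSelmerStructure W 3 0))
      (hg : AddSubgroup.zmultiples g = ⊤) =>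
    (kolyvaginSystems_idealOfBasis_levelOne_of_surj_of_localInputs W hS24₂ h3 τ hτμ hτq inv hperf
      hsum hunro hcompl hEP hLpIm S hS h3S hbadS D η hP hT hD inv' hperf' hsum' hunro' hcompl'
      g hg d hd).2
  have hexp : ∀ a : (inv'.dualSelmerStructure (W.torsionGaloisModule (((3 : ℕ) : ℤ) ^ 0 * ((3 : ℕ) : ℤ)))
      (D.atLevel (propagatedSelmerStructure W 3 0) d)).selmerGroup, 3 • a = 0 := fun a => by
    apply Subtype.ext
    rw [AddSubmonoidClass.coe_nsmul, ZeroMemClass.coe_zero]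
    have h := galoisCohomology.nsmul_eq_zero_of_forall
      ((W.torsionGaloisModule (((3 : ℕ) : ℤ) ^ 0 * ((3 : ℕ) : ℤ))).tateDual (3 ^ (0 + 1)))
      (fun f => DiscreteGaloisModule.TateDual.nsmul_eq_zero f) a.1
    simpa using h
  exact LevelOne.natCard_eq_one_of_apply_ne_zero Nat.prime_three
    (by simpa using hfree) hexp (fun g hg hdvd => h2 g hg (by simpa using hdvd)) κ hκ

end Summit.BirchSwinnertonDyer.Rank1Residual.GaloisImage

end
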